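/-
Origin: expansion seat `planner-pub-hodgecm-toy2-g5-0`, handover #7 2026-08-18T09:12:27Z (`HOME/pub-hodgecm-toy2-g5/lean/Toy2g5/PadH0Fund.lean`, md5 48817e8f, 221 lines);
landed by the gen-7 packager in gate run 27 as `HodgeCM/Model/PadH0Fund.lean` (import ^import Toy2g5\.PadH0\b→import HodgeCM.Model.PadH0 ×1; stripped 1 #print/#check/#eval lines).
-/
/-
Copyright: pub-hodgecm formalisation cell (harness21, 2026). New file (not vendored).
Origin: HOME/pub-hodgecm-toy2-g5/lean/Toy2g5/PadH0Fund.lean — session planner-pub-hodgecm-toy2-g5-0 (unit pub-hodgecm-toy2-g5,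
CONSISTENCY seat 2, part (6a)(ii), generation 5).  WIP module `Toy2g5.PadH0Fund`; intended final place
`HodgeCM/Model/PadH0Fund.lean` (module `HodgeCM.Model.PadH0Fund`).  ONE import to rewrite on landing:
`Toy2g5.PadH0` ↦ `HodgeCM.Model.PadH0`.
-/
import Summits.HodgeConjecture.HodgeCM.Model.PadH0_3
import Summits.HodgeConjecture.HodgeCM.StubTree.Qw8Milne
import Summits.HodgeConjecture.HodgeCM.Proofs.Pohlmann.WeightHodge
import Summits.HodgeConjecture.HodgeCM.Proofs.Pohlmann.DegreeZeroGeneric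

/-!
# Datum C for the degree-zero pad: `P(X) = H⁰(X, ℚ)` of type `(0,0)` — N5 `Fact_fundClass` and the degree-0 residue `Qw8MilneZero` are independent

The simplest pad datum of `HodgeCM.Model.PadH0`: a SECOND COPY of `H⁰`,

  `U.padDatumH0 : P(X) := H⁰(X, ℚ)`, structure pure of type `(0,0)`, `P(f) := f^*|_{H⁰}`,

whose pad laws hold in EVERY model (`PadH0Fund.laws (M)`: M1, M2; any linear map preserves the one-step filtration; M14
gives `(π∘s)^* = N⁰ = 1` on `H⁰`).  The padded universe `U♭⁰ := U.padH0 U.padDatumH0` ("every variety acquires a second,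
invisible connected component in degree `0`"):

* is a model (`modelAxioms (M) (hd)`), and N1, N2, **N3** (iff), **N4** (iff), F4, F5, `Fact_dimProd`, `W_RK4`, the
  realisation inputs transfer; hence **`PohlmannSpan`** (`pohlmannSpan_of_facts` inside `U♭⁰`) and **`Qw8MilnePos`**
  (`qw8MilnePos_of_facts` inside `U♭⁰`) HOLD in `U♭⁰` — §1;
* violates **N5 `Fact_fundClass`** (`Alg♭⁰ = Alg⁰ ⊕ 0 ≠ ⊤`), the **degree-0 residue `Qw8MilneZero`** of [QW8] Thm 2.5 (the
  pad vector `1 ⊗ (0, w)` is a nonzero weight vector of the empty weight — Lefschetz character `0` — and is not algebraic),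
  hence `Qw8Milne`, and **COR-CM** (`(0, w)` is a rational Hodge class of `H♭⁰(A_Φ)`), as soon as some `H⁰(A′, ℚ) ≠ 0`
  (`CMProdH0Nontrivial`, a theorem of M42 `Fact_H0_rank`) — §2.

So `Fact_fundClass` and `Qw8MilneZero` are independent of
`ModelAxioms ∧ N1 ∧ N2 ∧ N3 ∧ N4 ∧ F4 ∧ F5 ∧ Fact_dimProd ∧ W_RK4 ∧ PohlmannSpan ∧ Qw8MilnePos`
(`exists_model_not_fact_fundClass`; unconditional toy instance `HodgeCM.Toy.fact_fundClass_independent` in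
`HodgeCM.Model.Toy.ToyPadH0Fund`) — the formal counterpart of the remark in `HodgeCM.StubTree.Qw8Milne` that no binder of the
certified assembly yields an algebraic class of degree `0`.  Nothing is cited; Lean + Mathlib axioms only; `U♭⁰` claims no
print meaning.
-/

noncomputable section

open scoped TensorProduct

namespace HodgeCM

open Literature.AlgebraicGeometry.Motives (CMType HodgeStructure)
open Literature.AlgebraicGeometry.Motives.HodgeStructure (ofRat pureFiltration pureFiltration_of_le)

namespace Universe

variable (U : Universe)

/-- **Datum C**: the pad `P(X) := H⁰(X, ℚ)` purely of type `(0,0)`, with the pad action `P(f) := f^*|_{H⁰}`. -/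
def padDatumH0 : U.PadDatum where
  P X := U.Coh X 0
  hs X := HodgeStructure.pure (U.Coh X 0) 0 ((0 : ℕ) : ℤ) (by norm_num)
  map f := U.pull f 0

namespace PadH0Fund

variable {U}

/-- (Ported verbatim from the HodgeCMPerL package; no docstring in the source.) -/
theorem map_eq {X Y : U.Var} (f : U.Mor X Y) : U.padDatumH0.map f = U.pull f 0 := rfl

/-- (Ported verbatim from the HodgeCMPerL package; no docstring in the source.) -/
theorem hs_F (X : U.Var) (p : ℤ) : (U.padDatumH0.hs X).F p = pureFiltration (U.Coh X 0) 0 p := rfl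

/-- The pad structure has `F⁰ = ⊤` … -/
theorem hs_F_zero (X : U.Var) : (U.padDatumH0.hs X).F 0 = ⊤ := by
  rw [hs_F]; exact pureFiltration_of_le le_rfl

/-- … so every rational pad vector is a rational Hodge class of it. -/
theorem pad_hodgeClasses (X : U.Var) : (U.padDatumH0.hs X).hodgeClasses 0 = ⊤ :=
  eq_top_iff.mpr fun v _ => by
    rw [HodgeStructure.mem_hodgeClasses_iff, hs_F_zero]; exact Submodule.mem_top

/-! ## 1. `U♭⁰` is a model; everything transfers -/

/-- The pad laws hold in EVERY model: M1, M2 for `f^*|_{H⁰}`; every linear map preserves the one-step filtration; M14 gives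
`(π∘s)^* = N⁰ • 1 = 1` on `H⁰`. -/
theorem laws (M : U.ModelAxioms) : U.padDatumH0.Laws where
  map_id X := M.pull_id X 0
  map_comp X Y Z f g := M.pull_comp X Y Z f g 0
  map_hodge X Y f p := by
    rw [hs_F, hs_F]
    rintro _ ⟨x, hx, rfl⟩
    exact PadZero.map_mem_pureFiltration _ 0 p hx
  dominated X hX := by
    obtain ⟨F, hG, h6, n, Θ, s, π, N, hN, hk⟩ := M.cmDominated X hX
    exact ⟨F, hG, h6, n, Θ, s, π, N, hN, hk, by rw [map_eq, hk 0, pow_zero, one_smul]; rfl⟩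

/-- **`U♭⁰` is a model** whenever `U` is a model with `Fact_dimProd`. -/
theorem modelAxioms (M : U.ModelAxioms) (hd : U.Fact_dimProd) : (U.padH0 U.padDatumH0).ModelAxioms :=
  PadH0.modelAxioms M hd (laws M)

/-- N4 transfers both ways (the pad has `F⁰ = ⊤`). -/
theorem fact_hodge_F0_iff : (U.padH0 U.padDatumH0).Fact_hodge_F0 ↔ U.Fact_hodge_F0 :=
  ⟨fun h => (PadH0.fact_hodge_F0_iff.mp h).1, fun h => PadH0.fact_hodge_F0_iff.mpr ⟨h, hs_F_zero⟩⟩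

/-- N3 transfers both ways (the pad action of an endomorphism is `f^*|_{H⁰}`, trivial under N3). -/
theorem fact_pull_H0_iff : (U.padH0 U.padDatumH0).Fact_pull_H0 ↔ U.Fact_pull_H0 :=
  PadH0.fact_pull_H0_iff.trans ⟨fun h => h.1, fun h => ⟨h, h⟩⟩

/-- (Ported verbatim from the HodgeCMPerL package; no docstring in the source.) -/
theorem fact_cupExterior_iff : (U.padH0 U.padDatumH0).Fact_cupExterior ↔ U.Fact_cupExterior :=
  PadH0.fact_cupExterior_iff

/-- (Ported verbatim from the HodgeCMPerL package; no docstring in the source.) -/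
theorem fact_cup_hodge (h : U.Fact_cup_hodge) : (U.padH0 U.padDatumH0).Fact_cup_hodge := PadH0.fact_cup_hodge h

/-- (Ported verbatim from the HodgeCMPerL package; no docstring in the source.) -/
theorem fact_cupAlg (h : U.Fact_cupAlg) : (U.padH0 U.padDatumH0).Fact_cupAlg := PadH0.fact_cupAlg h

/-- (Ported verbatim from the HodgeCMPerL package; no docstring in the source.) -/
theorem fact_cupAssoc (h : U.Fact_cupAssoc) : (U.padH0 U.padDatumH0).Fact_cupAssoc := PadH0.fact_cupAssoc h

/-- (Ported verbatim from the HodgeCMPerL package; no docstring in the source.) -/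
theorem fact_dimProd_iff : (U.padH0 U.padDatumH0).Fact_dimProd ↔ U.Fact_dimProd := Iff.rfl

/-- (Ported verbatim from the HodgeCMPerL package; no docstring in the source.) -/
theorem w_RK4_iff : (U.padH0 U.padDatumH0).W_RK4 ↔ U.W_RK4 := Iff.rfl

/-- **Pohlmann's span inclusion HOLDS in `U♭⁰`** — by the package's own `pohlmannSpan_of_facts` applied inside `U♭⁰`
(although every pad vector is a rational Hodge class: under N3 it is a weight vector of the empty weight). -/
theorem pohlmannSpan (M : U.ModelAxioms) (hd : U.Fact_dimProd) (hN1 : U.Fact_cupExterior) (hN2 : U.Fact_cup_hodge)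
    (hN3 : U.Fact_pull_H0) (hN4 : U.Fact_hodge_F0) : (U.padH0 U.padDatumH0).PohlmannSpan :=
  pohlmannSpan_of_facts (modelAxioms M hd) (fact_cupExterior_iff.mpr hN1) (fact_cup_hodge hN2)
    (fact_pull_H0_iff.mpr hN3) (fact_hodge_F0_iff.mpr hN4)

/-- **`Qw8MilnePos` HOLDS in `U♭⁰`** (`qw8MilnePos_of_facts` inside `U♭⁰`). -/
theorem qw8MilnePos (M : U.ModelAxioms) (hd : U.Fact_dimProd) (hN1 : U.Fact_cupExterior) (hN2 : U.Fact_cup_hodge)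
    (hN3 : U.Fact_pull_H0) (hN4 : U.Fact_hodge_F0) (hF4 : U.Fact_cupAlg) (hF5 : U.Fact_cupAssoc) :
    (U.padH0 U.padDatumH0).Qw8MilnePos :=
  qw8MilnePos_of_facts (modelAxioms M hd) (fact_cupExterior_iff.mpr hN1) (fact_cup_hodge hN2)
    (fact_pull_H0_iff.mpr hN3) (fact_hodge_F0_iff.mpr hN4) (fact_cupAlg hF4) (fact_cupAssoc hF5)

/-! ## 2. `Fact_fundClass`, `Qw8MilneZero`, `Qw8Milne` and COR-CM fail in `U♭⁰` -/

set_option smartUnfolding false in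
/-- **N5 `Fact_fundClass` FAILS in `U♭⁰`** as soon as some `H⁰(A′, ℚ) ≠ 0`: a nonzero pad vector `(0, w) ∈ H♭⁰(A_Φ)` is not in
`Alg♭⁰(A_Φ) = Alg⁰(A_Φ) ⊕ 0`. -/
theorem not_fact_fundClass (h0 : U.CMProdH0Nontrivial) : ¬ (U.padH0 U.padDatumH0).Fact_fundClass := by
  intro h
  obtain ⟨F, -, -, f, -, -⟩ := faceHypothesesInhabited
  let Θ : Fin (0 + 1) → CMType F := fun _ => f.Φ
  haveI : Nontrivial (U.padDatumH0.P ((U.padH0 U.padDatumH0).cmProd F Θ)) := h0 F 0 Θ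
  obtain ⟨w, hw0⟩ := exists_ne (0 : U.padDatumH0.P ((U.padH0 U.padDatumH0).cmProd F Θ))
  have hm : PadH0.ofPad U.padDatumH0 ((U.padH0 U.padDatumH0).cmProd F Θ) 0 w ∈
      (U.padH0 U.padDatumH0).alg ((U.padH0 U.padDatumH0).cmProd F Θ) 0 := by
    rw [h]; exact Submodule.mem_top
  exact hw0 ((PadH0.ofPad_mem_alg_iff (D := U.padDatumH0) ((U.padH0 U.padDatumH0).cmProd F Θ) w).mp hm)

set_option smartUnfolding false in
/-- **The degree-0 residue `Qw8MilneZero` of [QW8] Thm 2.5 FAILS in `U♭⁰`** (given N3 in `U` and some `H⁰(A′, ℚ) ≠ 0`):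
`1 ⊗ (0, w)` is a nonzero weight vector of the EMPTY weight in `H♭⁰(A_Φ, ℂ)` (the pad action of a factor multiplication is
`M^*|_{H⁰} = 1` by N3), of Lefschetz character `0`, and it is not algebraic. -/
theorem not_qw8MilneZero (hN3 : U.Fact_pull_H0) (h0 : U.CMProdH0Nontrivial) : ¬ (U.padH0 U.padDatumH0).Qw8MilneZero := by
  intro hZ
  obtain ⟨F, hG, h6, f, -, -⟩ := faceHypothesesInhabited
  let Θ : Fin (0 + 1) → CMType F := fun _ => f.Φ
  haveI : Nontrivial (U.padDatumH0.P ((U.padH0 U.padDatumH0).cmProd F Θ)) := h0 F 0 Θ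
  obtain ⟨w, hw0⟩ := exists_ne (0 : U.padDatumH0.P ((U.padH0 U.padDatumH0).cmProd F Θ))
  let v : (U.padH0 U.padDatumH0).Coh ((U.padH0 U.padDatumH0).cmProd F Θ) (2 * 0) :=
    PadH0.ofPad U.padDatumH0 ((U.padH0 U.padDatumH0).cmProd F Θ) 0 w
  have hv0 : v ≠ 0 := fun hv => hw0 (by
    have h := congrArg (PadH0.padOf U.padDatumH0 ((U.padH0 U.padDatumH0).cmProd F Θ) 0) hv
    rwa [PadH0.padOf_ofPad_zero, map_zero] at h)
  let x : (U.padH0 U.padDatumH0).CohC ((U.padH0 U.padDatumH0).cmProd F Θ) (2 * 0) := ofRat v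
  have hx0 : x ≠ 0 := fun hx =>
    hv0 (PadZero.ofRat_injective (hx.trans (map_zero (ofRat : _ →ₗ[ℚ] ℂ ⊗[ℚ] _)).symm))
  have hw : (U.padH0 U.padDatumH0).IsWeightVector F Θ (fun _ => ∅) (2 * 0) x := by
    intro j a Ma _
    simp only [Finset.prod_empty, one_smul]
    show ((U.padH0 U.padDatumH0).pull Ma 0).baseChange ℂ ((1 : ℂ) ⊗ₜ v) = (1 : ℂ) ⊗ₜ v
    rw [LinearMap.baseChange_tmul]
    show (1 : ℂ) ⊗ₜ (U.padH0 U.padDatumH0).pull Ma 0 (PadH0.ofPad U.padDatumH0 _ 0 w) = _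
    rw [PadH0.pull_ofPad, map_eq, hN3 _ Ma]
    rfl
  have hchar : lefChar Θ (fun _ => (∅ : Finset ((F : Type) →+* ℂ))) = 0 := by
    unfold lefChar
    simp only [Finset.sum_empty, Finset.sum_const_zero]
  have halg := hZ F hG h6 ⟨0, Θ, 0, fun _ => ∅, x, hx0, hw⟩ rfl
  change x ∈ (U.padH0 U.padDatumH0).algC ((U.padH0 U.padDatumH0).cmProd F Θ) 0 at halg
  exact hw0 ((PadH0.ofPad_mem_alg_iff (D := U.padDatumH0) ((U.padH0 U.padDatumH0).cmProd F Θ) w).mp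
    (Universe.mem_alg_of_ofRat_mem_algC (U.padH0 U.padDatumH0) halg))

/-- … hence **`Qw8Milne` FAILS in `U♭⁰`** (its degree-0 residue does: `qw8MilneZero_of_qw8Milne`). -/
theorem not_qw8Milne (hN3 : U.Fact_pull_H0) (h0 : U.CMProdH0Nontrivial) : ¬ (U.padH0 U.padDatumH0).Qw8Milne :=
  fun h => not_qw8MilneZero hN3 h0 (qw8MilneZero_of_qw8Milne (fact_pull_H0_iff.mpr hN3) h)

set_option smartUnfolding false in
/-- **COR-CM FAILS in `U♭⁰`** (given `ModelAxioms` and some `H⁰(A′, ℚ) ≠ 0`): the pad vector `(0, w)` is a rational Hodge class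
of `H♭⁰(A_Φ)` which is not algebraic. -/
theorem not_hc_cm (M : U.ModelAxioms) (h0 : U.CMProdH0Nontrivial) : ¬ (U.padH0 U.padDatumH0).HC_CM := by
  intro hHC
  obtain ⟨F, -, -, f, -, -⟩ := faceHypothesesInhabited
  let Θ : Fin (0 + 1) → CMType F := fun _ => f.Φ
  haveI : Nontrivial (U.padDatumH0.P ((U.padH0 U.padDatumH0).cmProd F Θ)) := h0 F 0 Θ
  obtain ⟨w, hw0⟩ := exists_ne (0 : U.padDatumH0.P ((U.padH0 U.padDatumH0).cmProd F Θ))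
  have hX : (U.padH0 U.padDatumH0).IsCMAbelianVariety ((U.padH0 U.padDatumH0).cmProd F Θ) := (M.cmAV F f.Φ).2.1
  have hvH : w ∈ (U.padDatumH0.hs ((U.padH0 U.padDatumH0).cmProd F Θ)).hodgeClasses 0 := by
    rw [pad_hodgeClasses]; exact Submodule.mem_top
  have hm := PadH0.ofPad_mem_hodgeClassesOf (D := U.padDatumH0) ((U.padH0 U.padDatumH0).cmProd F Θ) hvH
  exact hw0 ((PadH0.ofPad_mem_alg_iff (D := U.padDatumH0) ((U.padH0 U.padDatumH0).cmProd F Θ) w).mp (hHC _ hX 0 hm))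

/-- **Separation theorem for N5 / the degree-0 residue.**  If `U` is a model with `Fact_dimProd`, N1–N4, F4, F5, `W_RK4`
and some `H⁰(A′, ℚ) ≠ 0`, then `U♭⁰` is a model with all of these, with `PohlmannSpan` and `Qw8MilnePos`, in which
`Fact_fundClass`, `Qw8MilneZero`, `Qw8Milne` and COR-CM FAIL. -/
theorem exists_model_not_fact_fundClass (M : U.ModelAxioms) (hd : U.Fact_dimProd) (hN1 : U.Fact_cupExterior)
    (hN2 : U.Fact_cup_hodge) (hN3 : U.Fact_pull_H0) (hN4 : U.Fact_hodge_F0) (hF4 : U.Fact_cupAlg)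
    (hF5 : U.Fact_cupAssoc) (hW : U.W_RK4) (h0 : U.CMProdH0Nontrivial) :
    ∃ U' : Universe, U'.ModelAxioms ∧ U'.Fact_dimProd ∧ U'.Fact_cupExterior ∧ U'.Fact_cup_hodge ∧ U'.Fact_pull_H0 ∧
      U'.Fact_hodge_F0 ∧ U'.Fact_cupAlg ∧ U'.Fact_cupAssoc ∧ U'.W_RK4 ∧ U'.PohlmannSpan ∧ U'.Qw8MilnePos ∧
      ¬ U'.Fact_fundClass ∧ ¬ U'.Qw8MilneZero ∧ ¬ U'.Qw8Milne ∧ ¬ U'.HC_CM :=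
  ⟨U.padH0 U.padDatumH0, modelAxioms M hd, fact_dimProd_iff.mpr hd, fact_cupExterior_iff.mpr hN1, fact_cup_hodge hN2,
    fact_pull_H0_iff.mpr hN3, fact_hodge_F0_iff.mpr hN4, fact_cupAlg hF4, fact_cupAssoc hF5, w_RK4_iff.mpr hW,
    pohlmannSpan M hd hN1 hN2 hN3 hN4, qw8MilnePos M hd hN1 hN2 hN3 hN4 hF4 hF5, not_fact_fundClass h0,
    not_qw8MilneZero hN3 h0, not_qw8Milne hN3 h0, not_hc_cm M h0⟩


end PadH0Fund

end Universe

end HodgeCM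

end
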